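import Literature.NumberTheory.IwasawaTheory.FukudaGroupLayers
import Literature.NumberTheory.IwasawaTheory.FukudaGrowthAlgebra
import HarnessLib

/-!
# Fukuda's Theorem 1 (2) at finite level — the two GROUP-THEORETIC steps: the rank step (Nakayama on `(Y₀ + pA)/pA`) and the
# growth inequality `[G_k : N_k]·#A ≤ [G_{k+1} : N_{k+1}]²` behind the rider `μ = 0`

Topic `NumberTheory/IwasawaTheory` (namespace = path). THEOREM-ONLY file (no definition, no named fact, no `sorry`), written by the
prover seat `bsd-potss-k8t-c4` g20 (cell `bsd-potss`; Fukuda road of stmt-BirchSwinnertonDyer-19982; closes nothing), on top of the layer brick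
`FukudaGroupLayers.lean` and the module algebra `FukudaGrowthAlgebra.lean`; consumed by the assembly of the finite-level proof of
`fukuda1994_thm1_classGroupPRank_const_of_succ_eq` (`ClassicalMuInvariant.lean` §5).

SETTING and NOTATION as in `FukudaGroupLayers.lean`: `G` finite, `A ◁ G` abelian of `p`-power order, `g` with `⟨g⟩ ∩ A = 1`, `A⟨g⟩ = G`,
`[G : A] = p^t`, `𝓘` the «inertia» family (`I ∩ A = 1`, `I = 1` or `IA = G`, `⟨g⟩ ∈ 𝓘`); `φ = conjEnd A g`, `N₀ = G'·⟨𝓘⟩`, `Y₀ = N₀ ∩ A`,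
`ν_j = ∑_{i<p^j} φ^i`, and for `G_j ⊇ A` of index `p^j`: `N_j = G_j'·⟨I ∩ G_j⟩`, `P_j = ⟨x^p : x ∈ G_j⟩`, `pA` = image of `p·1` on `Additive A`.
In the application (`G = Gal(H_p(K_{n+t})/K_n)`): `[G_j : N_j] = p^{e_{n+j}}`, `[G_j : N_j P_j] = p^{r_{n+j}}` (`e` = `ord_p h`, `r` = `p`-rank of `Cl`).

* `relIndex_commutator_sup_pow_eq_card_quotient` — RANK STEP (Fukuda's proof of Thm. 1 (2) with `Z = (Y + pX)/pX`): if
  `[G₀ : N₀P₀] = [G₁ : N₁P₁]` then `Y₀ ⊆ pA` and `[G_j : N_jP_j] = #(A/pA)` for EVERY layer `j ≤ t` («`rank A_m = rank X` for all `m`»).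
* `relIndex_mul_card_le_sq` — GROWTH STEP (finite shadow of «ranks bounded ⇒ `μ = 0`», Washington Prop. 13.23): if `#(A/pA) ≤ p^r`,
  `r ≤ p^{k₀}`, `k ≥ k₀ + 1` and `t = k + 2`, then `ν_{k+1}Y₀ = p·ν_kY₀`, `ν_{k+2}Y₀ = p²·ν_kY₀ = 0`, hence
  `[G_k : N_k] · #A ≤ [G_{k+1} : N_{k+1}]²`, i.e. `e_{n+k} + e_{n+k+2} ≤ 2 e_{n+k+1}`.

References: [Fukuda1994] T. Fukuda, Proc. Japan Acad. 70 A (1994), Thm. 1 (2) and its proof, p. 264; [Washington1997] §13.3 Lemmas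
13.15–13.18, Prop. 13.22, Prop. 13.23 (proof).
-/

noncomputable section

open Subgroup Finset Polynomial
open scoped IsMulCommutative

namespace Literature.NumberTheory.IwasawaTheory.FukudaGroup

variable {G : Type*} [Group G] {A : Subgroup G} [A.Normal] [IsMulCommutative A] [Finite G] {p : ℕ} [hp : Fact p.Prime]
  {g : G} {𝓘 : Set (Subgroup G)} {t : ℕ}

/-! ## §1 Auxiliary identities for `ν_j = ∑_{i<p^j} φ^i` -/

omit [A.Normal] [IsMulCommutative A] [Finite G] hp in
/-- `∑_{i<mn} φ^i = (∑_{j<n} (φ^m)^j)·(∑_{i<m} φ^i)` (in the commutative subring `ℤ[φ]`; proved in `ℤ[X]` and evaluated at `φ`).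
[cite: Washington1997, §13.3 Lemma 13.18 (`ν_{n+1} = ν_n · (1 + γ^{p^n} + ⋯)`)] -/
private theorem geom_sum_mul_eq {M : Type*} [AddCommGroup M] (φ : Module.End ℤ M) (m n : ℕ) :
    ∑ i ∈ range (m * n), φ ^ i = (∑ j ∈ range n, (φ ^ m) ^ j) * ∑ i ∈ range m, φ ^ i := by
  have h : ∑ i ∈ range (m * n), (X : ℤ[X]) ^ i = (∑ j ∈ range n, ((X : ℤ[X]) ^ m) ^ j) * ∑ i ∈ range m, (X : ℤ[X]) ^ i := by
    induction n with
    | zero => simp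
    | succ n ih =>
      rw [Nat.mul_succ, Finset.sum_range_add, ih, Finset.sum_range_succ, add_mul]
      congr 1
      rw [Finset.mul_sum]
      exact Finset.sum_congr rfl fun i _ => by ring
  have h2 := congrArg (aeval φ) h
  simp only [map_sum, map_mul, map_pow, aeval_X] at h2
  exact h2

omit [A.Normal] [IsMulCommutative A] [Finite G] hp in
/-- A `φ`-stable submodule is stable under every `∑ c_i φ^i`-type endomorphism built from powers: here under `φ^n`. [folklore] -/
private theorem pow_apply_mem' {M : Type*} [AddCommGroup M] (φ : Module.End ℤ M) (W : Submodule ℤ M) (hW : ∀ w ∈ W, φ w ∈ W)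
    (n : ℕ) {w : M} (hw : w ∈ W) : (φ ^ n) w ∈ W := by
  induction n generalizing w with
  | zero => simpa using hw
  | succ n ih => rw [pow_succ, Module.End.mul_apply]; exact ih (hW w hw)

omit [A.Normal] [IsMulCommutative A] [Finite G] hp in
/-- `(∑_{i<m} φ^i) w ∈ W` for `w` in a `φ`-stable `W`. [folklore] -/
private theorem geom_sum_apply_mem {M : Type*} [AddCommGroup M] (φ : Module.End ℤ M) (W : Submodule ℤ M)
    (hW : ∀ w ∈ W, φ w ∈ W) (m : ℕ) {w : M} (hw : w ∈ W) : (∑ i ∈ range m, φ ^ i) w ∈ W := by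
  rw [LinearMap.sum_apply]
  exact W.sum_mem fun i _ => pow_apply_mem' φ W hW i hw

/-! ## §2 The rank step -/

/-- **RANK STEP (Fukuda 1994, proof of Thm. 1 (2), at finite level).** In the setting of `FukudaGroupLayers`: if the layers `G₀ = G` and `G₁` (index `p`) have `[G₀ : N₀P₀] = [G₁ : N₁P₁]` («`rank A_n = rank A_{n+1}`»), then `Y₀ ⊆ pA`
(Nakayama: `Y₀ ⊆ νY₀ + pA ⇒ Y₀ ⊆ ν^{p^t}Y₀ + pA = p·T(φ)Y₀ + pA = pA`) and consequently **`[G_j : N_jP_j] = #(A/pA)` for every layer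
`G_j ⊇ A` of index `p^j`, `j ≤ t`** («`rank A_m = rank X/pX` for all `m ≥ n`»). [cite: Fukuda1994, Thm. 1 (2), p. 264 (proof: `Z = (Y + pX)/pX`,
`ν_{0,1}Z = Z`, Nakayama, `Y ⊂ pX`)] [cite: Washington1997, §13.3 Lemma 13.18 and Prop. 13.22] -/
theorem relIndex_commutator_sup_pow_eq_card_quotient (hgA : Subgroup.zpowers g ⊓ A = ⊥) (hgen : A ⊔ Subgroup.zpowers g = ⊤)
    (hind : A.index = p ^ t) (h𝓘 : ∀ I ∈ 𝓘, I ⊓ A = ⊥ ∧ (I = ⊥ ∨ I ⊔ A = ⊤)) (hg𝓘 : Subgroup.zpowers g ∈ 𝓘)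
    (ht : 1 ≤ t) {G₀ : Subgroup G} (hAG₀ : A ≤ G₀) (hG₀ : G₀.index = p ^ 0) {G₁ : Subgroup G} (hAG₁ : A ≤ G₁) (hG₁ : G₁.index = p ^ 1)
    (h : ((⁅G₀, G₀⁆ ⊔ ⨆ I ∈ 𝓘, I ⊓ G₀) ⊔ Subgroup.closure ((fun x : G => x ^ p) '' (G₀ : Set G))).relIndex G₀ =
      ((⁅G₁, G₁⁆ ⊔ ⨆ I ∈ 𝓘, I ⊓ G₁) ⊔ Subgroup.closure ((fun x : G => x ^ p) '' (G₁ : Set G))).relIndex G₁)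
    {j : ℕ} (hj : j ≤ t) {Gj : Subgroup G} (hAGj : A ≤ Gj) (hGj : Gj.index = p ^ j) :
    ((⁅Gj, Gj⁆ ⊔ ⨆ I ∈ 𝓘, I ⊓ Gj) ⊔ Subgroup.closure ((fun x : G => x ^ p) '' (Gj : Set G))).relIndex Gj =
      Nat.card (Additive A ⧸ (⊤ : Submodule ℤ (Additive A)).map ((p : ℤ) • (1 : Module.End ℤ (Additive A)))) := by
  classical
  set φ : Module.End ℤ (Additive A) := conjEnd A g with hφ
  set Y₀ : Submodule ℤ (Additive A) := subOf A (⁅(⊤ : Subgroup G), ⊤⁆ ⊔ ⨆ I ∈ 𝓘, I) with hY₀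
  set π : Module.End ℤ (Additive A) := (p : ℤ) • (1 : Module.End ℤ (Additive A)) with hπ
  set Q : Submodule ℤ (Additive A) := (⊤ : Submodule ℤ (Additive A)).map π with hQ
  have hπapp : ∀ x, π x = (p : ℤ) • x := fun x => by rw [hπ, LinearMap.smul_apply, Module.End.one_apply]
  have hmemQ : ∀ x, x ∈ Q ↔ ∃ u, (p : ℤ) • u = x := fun x => by
    rw [hQ, Submodule.mem_map]
    exact ⟨fun ⟨u, _, hu⟩ => ⟨u, by rw [← hu, hπapp]⟩, fun ⟨u, hu⟩ => ⟨u, Submodule.mem_top, by rw [hπapp, hu]⟩⟩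
  -- `Y₀` is `φ`-stable; `φ^{p^t} = 1`
  have hY₀stab : ∀ y ∈ Y₀, φ y ∈ Y₀ := fun y hy => conjEnd_mem_subOf_commutator_sup hgA hgen hind h𝓘 hg𝓘 hy
  have hφt : φ ^ p ^ t = 1 := conjEnd_pow_index_eq_one hgA hgen hind
  -- the index formulas of the two layers
  have h0 := relIndex_commutator_sup_layer_pow_mul_card hgA hgen hind h𝓘 hg𝓘 (Nat.zero_le t) hAG₀ hG₀
  have h1 := relIndex_commutator_sup_layer_pow_mul_card hgA hgen hind h𝓘 hg𝓘 ht hAG₁ hG₁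
  rw [← hφ, ← hY₀, ← hπ, ← hQ] at h0 h1
  have hν0 : (∑ i ∈ range (p ^ 0), φ ^ i) = 1 := by rw [pow_zero, Finset.range_one, Finset.sum_singleton, pow_zero]
  have hmap1 : Y₀.map (1 : Module.End ℤ (Additive A)) = Y₀ := by ext x; simp [Submodule.mem_map]
  rw [hν0, hmap1] at h0
  set ν : Module.End ℤ (Additive A) := ∑ i ∈ range (p ^ 1), φ ^ i with hν
  -- `#(Y₀ + pA) = #(νY₀ + pA)` and `νY₀ + pA ≤ Y₀ + pA`, hence equality
  have hcard : Nat.card ↥(Y₀ ⊔ Q) = Nat.card ↥(Y₀.map ν ⊔ Q) := by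
    have hpos : 0 < ((⁅G₀, G₀⁆ ⊔ ⨆ I ∈ 𝓘, I ⊓ G₀) ⊔ Subgroup.closure ((fun x : G => x ^ p) '' (G₀ : Set G))).relIndex G₀ :=
      Nat.pos_of_ne_zero (by rw [Subgroup.relIndex]; exact Subgroup.index_ne_zero_of_finite)
    rw [h] at h0 hpos
    exact Nat.eq_of_mul_eq_mul_left hpos (h0.trans h1.symm)
  have hle : Y₀.map ν ⊔ Q ≤ Y₀ ⊔ Q :=
    sup_le_sup_right (Submodule.map_le_iff_le_comap.mpr fun y hy =>
      Submodule.mem_comap.mpr (geom_sum_apply_mem φ Y₀ hY₀stab _ hy)) Q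
  have heq : Y₀.map ν ⊔ Q = Y₀ ⊔ Q :=
    SetLike.coe_injective (Set.Finite.eq_of_subset_of_card_le (Set.toFinite _) hle (le_of_eq hcard))
  -- Nakayama without quotients: `Y₀ ⊆ ν^i Y₀ + pA` for all `i`, and `ν^{p^t} = p·T(φ)`
  have hQstab : ∀ q ∈ Q, ∀ n : ℕ, (φ ^ n) q ∈ Q := by
    intro q hq n
    obtain ⟨u, rfl⟩ := (hmemQ q).mp hq
    rw [map_zsmul]
    exact (hmemQ _).mpr ⟨_, rfl⟩
  have hQν : ∀ q ∈ Q, ∀ i : ℕ, (ν ^ i) q ∈ Q := by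
    intro q hq i
    induction i with
    | zero => simpa using hq
    | succ i ih =>
      rw [pow_succ', Module.End.mul_apply, hν, LinearMap.sum_apply]
      exact Q.sum_mem fun n _ => hQstab _ ih n
  have hiter : ∀ i : ℕ, Y₀ ≤ Y₀.map (ν ^ i) ⊔ Q := by
    intro i
    induction i with
    | zero => rw [pow_zero, hmap1]; exact le_sup_left
    | succ i ih =>
      intro y hy
      have hy' : y ∈ Y₀.map ν ⊔ Q := by rw [heq]; exact Submodule.mem_sup_left hy
      obtain ⟨z, hz, q, hq, rfl⟩ := Submodule.mem_sup.mp hy'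
      obtain ⟨y₁, hy₁, rfl⟩ := Submodule.mem_map.mp hz
      -- `y₁ ∈ Y₀ ≤ ν^i Y₀ + Q`
      obtain ⟨z₁, hz₁, q₁, hq₁, hzq⟩ := Submodule.mem_sup.mp (ih hy₁)
      obtain ⟨y₂, hy₂, rfl⟩ := Submodule.mem_map.mp hz₁
      rw [← hzq, map_add]
      refine Submodule.add_mem _ (Submodule.add_mem _ (Submodule.mem_sup_left ?_) (Submodule.mem_sup_right ?_))
        (Submodule.mem_sup_right hq)
      · rw [← Module.End.mul_apply, ← pow_succ']
        exact Submodule.mem_map_of_mem hy₂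
      · have := hQν q₁ hq₁ 1
        rwa [pow_one] at this
  obtain ⟨T, hT⟩ := FukudaNakayama.exists_geom_sum_pow_eq_smul p t φ hφt
  have hφpoly : ∀ (S : ℤ[X]) (y : Additive A), y ∈ Y₀ → aeval φ S y ∈ Y₀ := by
    intro S y hy
    induction S using Polynomial.induction_on' with
    | add S₁ S₂ h₁ h₂ => rw [map_add, LinearMap.add_apply]; exact Y₀.add_mem h₁ h₂
    | monomial n c =>
      rw [← C_mul_X_pow_eq_monomial, map_mul, map_pow, aeval_C, aeval_X, Module.End.mul_apply, algebraMap_int_eq, eq_intCast,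
        Module.End.intCast_apply]
      exact Y₀.smul_mem _ (pow_apply_mem' φ Y₀ hY₀stab n hy)
  have hY₀Q : Y₀ ≤ Q := by
    intro y hy
    have h2 := hiter (p ^ t) hy
    rw [hν, pow_one] at h2
    rw [hT] at h2
    obtain ⟨z, hz, q, hq, rfl⟩ := Submodule.mem_sup.mp h2
    refine Q.add_mem ?_ hq
    obtain ⟨y₁, -, rfl⟩ := Submodule.mem_map.mp hz
    rw [LinearMap.smul_apply]
    exact (hmemQ _).mpr ⟨_, rfl⟩
  -- consequently `ν_j Y₀ + pA = pA` for every layer, and `[G_j : N_jP_j] = #A/#pA = #(A/pA)`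
  have hj' := relIndex_commutator_sup_layer_pow_mul_card hgA hgen hind h𝓘 hg𝓘 hj hAGj hGj
  rw [← hφ, ← hY₀, ← hπ, ← hQ] at hj'
  have hsup : Y₀.map (∑ i ∈ range (p ^ j), φ ^ i) ⊔ Q = Q := by
    apply le_antisymm
    · refine sup_le ?_ le_rfl
      rw [Submodule.map_le_iff_le_comap]
      intro y hy
      rw [Submodule.mem_comap, LinearMap.sum_apply]
      exact Q.sum_mem fun n _ => hQstab _ (hY₀Q hy) n
    · exact le_sup_right
  rw [hsup] at hj'
  have hcardA : Nat.card A = Nat.card Q * Nat.card (Additive A ⧸ Q) := Submodule.card_eq_card_quotient_mul_card Q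
  rw [hcardA, mul_comm (Nat.card Q)] at hj'
  exact Nat.eq_of_mul_eq_mul_right Nat.card_pos hj'

/-! ## §3 The growth step -/

/-- **GROWTH STEP (the rider «`μ = 0`» of Fukuda 1994 Thm. 1 (2), finite shadow of Washington Prop. 13.23 «ranks bounded ⇒ `μ = 0`»).**
In the setting of `FukudaGroupLayers`, with `A` of `p`-power order, `#(A/pA) ≤ p^r`, `r ≤ p^{k₀}`, `k ≥ k₀ + 1` and `[G : A] = p^{k+2}`:
for the layers `G_k ⊇ G_{k+1} ⊇ A` of indices `p^k`, `p^{k+1}` one has **`[G_k : N_k] · #A ≤ [G_{k+1} : N_{k+1}]²`**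
(`= e_{n+k} + e_{n+k+2} ≤ 2e_{n+k+1}` in the application).  PROOF: `Y = ν_kY₀` has `#(Y/pY) ≤ #(A/pA) ≤ p^r`; unipotence mod `p`
(`FukudaNakayama.sub_one_apply_mem_map_of_card_le`) gives `(φ^{p^{k₀}} − 1)Y ⊆ pY`, hence `(φ^{p^k} − 1)Y ⊆ p²Y`, so
`ν_{k+1}Y₀ = (1 + φ^{p^k} + ⋯)Y = pY` and `ν_{k+2}Y₀ = p²Y`; but `ν_{k+2}Y₀ = 0` (top layer), so `p²Y = 0` and `#(pY)² ≤ #Y`; with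
`[G_k : N_k]·#Y = #A = [G_{k+1} : N_{k+1}]·#(pY)` the inequality follows.
[cite: Fukuda1994, Thm. 1 (2), p. 264 («in particular `μ_p(K/k) = 0`»)] [cite: Washington1997, §13.3 Prop. 13.23 (proof) and Lemma 13.18] -/
theorem relIndex_mul_card_le_sq (hgA : Subgroup.zpowers g ⊓ A = ⊥) (hgen : A ⊔ Subgroup.zpowers g = ⊤)
    (hind : A.index = p ^ t) (h𝓘 : ∀ I ∈ 𝓘, I ⊓ A = ⊥ ∧ (I = ⊥ ∨ I ⊔ A = ⊤)) (hg𝓘 : Subgroup.zpowers g ∈ 𝓘)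
    (hA : ∃ a : ℕ, Nat.card A = p ^ a) {r k₀ k : ℕ}
    (hr : Nat.card (Additive A ⧸ (⊤ : Submodule ℤ (Additive A)).map ((p : ℤ) • (1 : Module.End ℤ (Additive A)))) ≤ p ^ r)
    (hk₀ : r ≤ p ^ k₀) (hk : k₀ + 1 ≤ k) (ht : t = k + 2)
    {Gk : Subgroup G} (hAGk : A ≤ Gk) (hGk : Gk.index = p ^ k)
    {Gk1 : Subgroup G} (hAGk1 : A ≤ Gk1) (hGk1 : Gk1.index = p ^ (k + 1)) :
    (⁅Gk, Gk⁆ ⊔ ⨆ I ∈ 𝓘, I ⊓ Gk).relIndex Gk * Nat.card A ≤ ((⁅Gk1, Gk1⁆ ⊔ ⨆ I ∈ 𝓘, I ⊓ Gk1).relIndex Gk1) ^ 2 := by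
  classical
  set φ : Module.End ℤ (Additive A) := conjEnd A g with hφ
  set Y₀ : Submodule ℤ (Additive A) := subOf A (⁅(⊤ : Subgroup G), ⊤⁆ ⊔ ⨆ I ∈ 𝓘, I) with hY₀
  set π : Module.End ℤ (Additive A) := (p : ℤ) • (1 : Module.End ℤ (Additive A)) with hπ
  have hπapp : ∀ x, π x = (p : ℤ) • x := fun x => by rw [hπ, LinearMap.smul_apply, Module.End.one_apply]
  have hkt : k ≤ t := by omega
  have hk1t : k + 1 ≤ t := by omega
  have hφt : φ ^ p ^ t = 1 := conjEnd_pow_index_eq_one hgA hgen hind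
  have hM : ∃ a : ℕ, Nat.card (Additive A) = p ^ a := hA
  -- `Y = ν_k Y₀`, `φ`-stable
  set Y : Submodule ℤ (Additive A) := Y₀.map (∑ i ∈ range (p ^ k), φ ^ i) with hY
  have hYstab : ∀ y ∈ Y, φ y ∈ Y := fun y hy => conjEnd_mem_map_subOf_commutator_sup hgA hgen hind h𝓘 hg𝓘 k hy
  -- index formulas: `r_k · #Y = #A`, `r_{k+1} · #Y_{k+1} = #A`, and `Y_{k+2} = 0`
  have hIk := relIndex_commutator_sup_layer_mul_card hgA hgen hind h𝓘 hg𝓘 hkt hAGk hGk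
  have hIk1 := relIndex_commutator_sup_layer_mul_card hgA hgen hind h𝓘 hg𝓘 hk1t hAGk1 hGk1
  have htop := map_subOf_commutator_sup_index_eq_bot hgA hgen hind h𝓘 hg𝓘
  rw [← hφ, ← hY₀] at hIk hIk1 htop
  rw [← hY] at hIk
  -- `ν_{k+1} = Φ_k ∘ ν_k`, `ν_{k+2} = Φ_{k+1} ∘ ν_{k+1}` with `Φ_j = ∑_{i<p} (φ^{p^j})^i`
  have hνk1 : (∑ i ∈ range (p ^ (k + 1)), φ ^ i) = (∑ i ∈ range p, (φ ^ p ^ k) ^ i) * ∑ i ∈ range (p ^ k), φ ^ i := by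
    rw [pow_succ]; exact geom_sum_mul_eq φ (p ^ k) p
  have hνk2 : (∑ i ∈ range (p ^ (k + 2)), φ ^ i) = (∑ i ∈ range p, (φ ^ p ^ (k + 1)) ^ i) * ∑ i ∈ range (p ^ (k + 1)), φ ^ i := by
    rw [pow_succ]; exact geom_sum_mul_eq φ (p ^ (k + 1)) p
  have hYk1 : Y₀.map (∑ i ∈ range (p ^ (k + 1)), φ ^ i) = Y.map (∑ i ∈ range p, (φ ^ p ^ k) ^ i) := by
    rw [hνk1, Module.End.mul_eq_comp, Submodule.map_comp]
  have hYk2 : Y₀.map (∑ i ∈ range (p ^ (k + 2)), φ ^ i) =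
      (Y.map (∑ i ∈ range p, (φ ^ p ^ k) ^ i)).map (∑ i ∈ range p, (φ ^ p ^ (k + 1)) ^ i) := by
    rw [hνk2, Module.End.mul_eq_comp, Submodule.map_comp, hYk1]
  -- ### unipotence: `(φ^{p^{k₀}} - 1) Y ⊆ pY`, hence `(φ^{p^k} - 1) Y ⊆ p²Y`
  have hr' : Nat.card (Additive A ⧸ LinearMap.range ((p : ℤ) • (1 : Module.End ℤ (Additive A)))) ≤ p ^ r := by
    rw [← Submodule.map_top]; exact hr
  have hu₀ : ∀ y ∈ Y, (φ ^ (p ^ k₀) - 1) y ∈ Y.map π :=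
    FukudaNakayama.sub_one_apply_mem_map_of_card_le hM φ hφt hr' hk₀ Y hYstab
  have hu₁ : ∀ y ∈ Y, (φ ^ (p ^ (k₀ + 1)) - 1) y ∈ (Y.map π).map π :=
    FukudaNakayama.sub_one_apply_mem_map_map_of φ Y hYstab hu₀
  -- pass from `k₀ + 1` to `k`: `φ^{p^k} = (φ^{p^{k₀+1}})^{p^{k - k₀ - 1}}`
  have huk : ∀ y ∈ Y, (φ ^ (p ^ k) - 1) y ∈ (Y.map π).map π := by
    obtain ⟨d, hd⟩ := Nat.exists_eq_add_of_le hk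
    have hpow : φ ^ (p ^ k) = (φ ^ (p ^ (k₀ + 1))) ^ (p ^ d) := by rw [← pow_mul, ← pow_add, hd]
    rw [hpow]
    exact FukudaNakayama.pow_sub_one_apply_mem _ Y _ (fun y hy => pow_apply_mem' φ Y hYstab _ hy) hu₁ _
  -- ### `Y_{k+1} = Φ_k Y = pY`
  have hΦk : Y.map (∑ i ∈ range p, (φ ^ p ^ k) ^ i) = Y.map π :=
    FukudaNakayama.map_geom_sum_eq_map_smul hM (φ ^ p ^ k) Y (fun y hy => pow_apply_mem' φ Y hYstab _ hy) huk
  -- ### `Y_{k+2} = Φ_{k+1} (pY) = p²Y`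
  have hstab' : ∀ y ∈ Y.map π, (φ ^ p ^ (k + 1)) y ∈ Y.map π := by
    intro y hy
    obtain ⟨u, hu, rfl⟩ := Submodule.mem_map.mp hy
    rw [hπapp, map_zsmul, ← hπapp]
    exact Submodule.mem_map_of_mem (pow_apply_mem' φ Y hYstab _ hu)
  have huk1 : ∀ y ∈ Y.map π, (φ ^ (p ^ (k + 1)) - 1) y ∈ ((Y.map π).map π).map π := by
    intro y hy
    obtain ⟨u, hu, rfl⟩ := Submodule.mem_map.mp hy
    have h1 : (φ ^ (p ^ (k + 1)) - 1) (π u) = π ((φ ^ (p ^ (k + 1)) - 1) u) := by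
      rw [hπapp, hπapp, map_zsmul]
    rw [h1]
    refine Submodule.mem_map_of_mem ?_
    -- `(φ^{p^{k+1}} - 1) u = ((φ^{p^k})^p - 1) u ∈ p²Y`
    have h2 : φ ^ (p ^ (k + 1)) = (φ ^ p ^ k) ^ p := by rw [← pow_mul, ← pow_succ]
    rw [h2]
    exact FukudaNakayama.pow_sub_one_apply_mem _ Y _ (fun y hy => pow_apply_mem' φ Y hYstab _ hy) huk p u hu
  have hΦk1 : (Y.map π).map (∑ i ∈ range p, (φ ^ p ^ (k + 1)) ^ i) = (Y.map π).map π :=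
    FukudaNakayama.map_geom_sum_eq_map_smul hM (φ ^ p ^ (k + 1)) (Y.map π) hstab' huk1
  -- ### `p²Y = 0` (the top layer `k + 2 = t`)
  have hp2Y : (Y.map π).map π = ⊥ := by
    rw [← hΦk1, ← hΦk, ← hYk2, ← ht]
    exact htop
  -- ### counting
  have hsq : Nat.card ↥(Y.map π) ^ 2 ≤ Nat.card Y := FukudaNakayama.card_map_smul_sq_le p Y hp2Y
  rw [hYk1, hΦk] at hIk1
  -- `r_k · #Y = #A`, `r_{k+1} · #(pY) = #A`
  have hYpos : 0 < Nat.card Y := Nat.card_pos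
  apply Nat.le_of_mul_le_mul_right _ hYpos
  calc (⁅Gk, Gk⁆ ⊔ ⨆ I ∈ 𝓘, I ⊓ Gk).relIndex Gk * Nat.card A * Nat.card Y
      = Nat.card A * Nat.card A := by rw [mul_assoc, mul_comm (Nat.card A) (Nat.card Y), ← mul_assoc, hIk]
    _ = ((⁅Gk1, Gk1⁆ ⊔ ⨆ I ∈ 𝓘, I ⊓ Gk1).relIndex Gk1 * Nat.card ↥(Y.map π)) ^ 2 := by rw [hIk1, pow_two]
    _ = (⁅Gk1, Gk1⁆ ⊔ ⨆ I ∈ 𝓘, I ⊓ Gk1).relIndex Gk1 ^ 2 * Nat.card ↥(Y.map π) ^ 2 := by rw [mul_pow]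
    _ ≤ (⁅Gk1, Gk1⁆ ⊔ ⨆ I ∈ 𝓘, I ⊓ Gk1).relIndex Gk1 ^ 2 * Nat.card Y := Nat.mul_le_mul_left _ hsq

end Literature.NumberTheory.IwasawaTheory.FukudaGroup

end
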